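import Literature.Analysis.FunctionSpaces.LatticeSymbolAlgebra
import HarnessLib

/-!
# The commutator of a periodic operator with a smooth cutoff (Warner 6.32 (10)–(11), 6.33 (3))

Continuation of `LatticeSymbolAlgebra.lean`. For `L` in the normal form `Lattice.POp`
(`L u = ∑ A_{ij}∂_i∂_j u + ∑ b_{ij} ⋆ ∂_i∂_j u + ∑ c_j ⋆ ∂_j u + c₀ ⋆ u`) and a scalar multiplier
`ω ⋆` (symbol `Lattice.scal χ`, `χ = ω̂` rapidly decreasing), F. W. Warner (GTM 94 (1983), 6.32
(10)–(11)) writes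

  `L̃(ω ũ) = ω L̃ũ + M ũ`,  `M = L̃ω - ωL̃` an operator of order `1`

(and uses the same commutator in 6.33 (3)). Here:

* `Lattice.POp.cutoffComm L χ` — **the commutator `[L, ω⋆]` as a first-order operator** (a
  `Lattice.POp1` without constant first-order part; its symbols are the products of the symbols
  of `L` with the first and second derivatives of `χ`, by the Leibniz rule), and the identity
  `L (ω ⋆ u) = ω ⋆ (L u) + [L, ω⋆] u` for tempered `u` (`Lattice.POp.apply_conv_scal`);
* `Lattice.POp1.apply_conv_scal_eq` — **locality** (Warner 6.32 (15): "`M₂ũ = M₂v₁` since `M₂`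
  has support in `O₁` and `ũ = v₁ = ω₁ũ` on `O₁`"), in the symbolic form in which it is used: if
  the symbols `p_j, p₀` of a first-order operator `M` (without constant part) are annihilated by
  `ψ - 1` and the `p_j` by `∂_jψ` (on the torus: `p · (ψ - 1) = 0`, `p_j · ∂_jψ = 0`, which holds
  when `ψ = 1` on a neighbourhood of the supports), then `M (ψ ⋆ u) = M u`.

## References

* F. W. Warner, *Foundations of Differentiable Manifolds and Lie Groups*, GTM 94 (1983), 6.32
  (10), (11), (15); 6.33 (3). [WarnerGTM94]
-/

open Filter Finset
open scoped ENNReal NNReal Topology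

noncomputable section

namespace Literature.Analysis.FunctionSpaces

namespace Lattice

open Torus

variable {d : Type*} [Fintype d]
variable {V W : Type*} [NormedAddCommGroup V] [NormedSpace ℂ V] [NormedAddCommGroup W]
  [NormedSpace ℂ W]

/-! ### The commutator with a scalar multiplier -/

namespace POp

variable (L : POp d V W)

/-- **The commutator `[L, ω⋆]` of a periodic operator of order `≤ 2` with the multiplier by a
scalar function `ω` (symbol `scal χ`, `χ = ω̂`)**, as a first-order operator without constant part
(Warner 6.32 (11): `M = L̃ω - ωL̃` "is of order `1`"). By the Leibniz rule its symbols are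

* `p_j = ∑_i (A_{ij} ∂_iχ + A_{ji} ∂_iχ + b_{ij} ⋆ ∂_iχ + b_{ji} ⋆ ∂_iχ)`,
* `p₀ = ∑_{ij} (A_{ij} ∂_i∂_jχ + b_{ij} ⋆ ∂_i∂_jχ) + ∑_j c_j ⋆ ∂_jχ`.
[cite: WarnerGTM94, 6.32 (11)] -/
def cutoffComm (χ : (d → ℤ) → ℂ) (hχ : RapidDecay χ) : POp1 d V W where
  P := fun _ => 0
  p := fun j => ∑ i, (compLeft (L.A i j) (freqDeriv i (scal χ)) + compLeft (L.A j i) (freqDeriv i (scal χ)) +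
    (sconv (L.b i j) (freqDeriv i (scal χ)) + sconv (L.b j i) (freqDeriv i (scal χ))))
  p0 := ∑ i, ∑ j, (compLeft (L.A i j) (freqDeriv i (freqDeriv j (scal χ))) +
      sconv (L.b i j) (freqDeriv i (freqDeriv j (scal χ)))) +
    ∑ j, sconv (L.c1 j) (freqDeriv j (scal χ))
  hp := fun j => RapidDecay.finset_sum _ fun i _ =>
    (((hχ.scal.freqDeriv i).compLeft (L.A i j)).add ((hχ.scal.freqDeriv i).compLeft (L.A j i))).add
      (((L.hb i j).sconv (hχ.scal.freqDeriv i)).add ((L.hb j i).sconv (hχ.scal.freqDeriv i)))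
  hp0 := (RapidDecay.finset_sum _ fun i _ => RapidDecay.finset_sum _ fun j _ =>
      (((hχ.scal.freqDeriv j).freqDeriv i).compLeft (L.A i j)).add
        ((L.hb i j).sconv ((hχ.scal.freqDeriv j).freqDeriv i))).add
    (RapidDecay.finset_sum _ fun j _ => (L.hc1 j).sconv (hχ.scal.freqDeriv j))

/-- The commutator has no constant first-order part. [folklore] -/
@[simp] theorem cutoffComm_P (χ : (d → ℤ) → ℂ) (hχ : RapidDecay χ) (j : d) : (L.cutoffComm χ hχ).P j = 0 := rfl

/-- The first-order symbols of the commutator. [folklore] -/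
theorem cutoffComm_p (χ : (d → ℤ) → ℂ) (hχ : RapidDecay χ) (j : d) : (L.cutoffComm χ hχ).p j =
    ∑ i, (compLeft (L.A i j) (freqDeriv i (scal χ)) + compLeft (L.A j i) (freqDeriv i (scal χ)) +
      (sconv (L.b i j) (freqDeriv i (scal χ)) + sconv (L.b j i) (freqDeriv i (scal χ)))) := rfl

/-- The order-zero symbol of the commutator. [folklore] -/
theorem cutoffComm_p0 (χ : (d → ℤ) → ℂ) (hχ : RapidDecay χ) : (L.cutoffComm χ hχ).p0 =
    ∑ i, ∑ j, (compLeft (L.A i j) (freqDeriv i (freqDeriv j (scal χ))) +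
        sconv (L.b i j) (freqDeriv i (freqDeriv j (scal χ)))) +
      ∑ j, sconv (L.c1 j) (freqDeriv j (scal χ)) := rfl

variable [CompleteSpace V] [CompleteSpace W]

/-- **`L (ω ⋆ u) = ω ⋆ (L u) + [L, ω⋆] u` for tempered `u`** (Warner 6.32 (10)–(11),
`L̃ω₁ũ = ω₁L̃ũ + M₁ũ`): the Leibniz rule `∂_i∂_j(ω u) = (∂_i∂_jω)u + (∂_jω)∂_iu + (∂_iω)∂_ju + ω∂_i∂_ju`
and the commutation of the scalar multiplier with the coefficients of `L`.
[cite: WarnerGTM94, 6.32 (10)] -/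
theorem apply_conv_scal {χ : (d → ℤ) → ℂ} (hχ : RapidDecay χ) {u : (d → ℤ) → V} (hu : Tempered u) :
    L.apply (conv (scal χ) u) = conv (scal χ) (L.apply u) + (L.cutoffComm χ hχ).apply u := by
  have hs : RapidDecay (scal χ : (d → ℤ) → (V →L[ℂ] V)) := hχ.scal
  have hsW : RapidDecay (scal χ : (d → ℤ) → (W →L[ℂ] W)) := hχ.scal
  -- the Leibniz rule
  have F1 : ∀ j, freqDeriv j (conv (scal χ) u) = conv (freqDeriv j (scal χ)) u + conv (scal χ) (freqDeriv j u) :=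
    fun j => freqDeriv_conv hs hu j
  have F2 : ∀ i j, freqDeriv i (freqDeriv j (conv (scal χ) u)) =
      conv (freqDeriv i (freqDeriv j (scal χ))) u + conv (freqDeriv j (scal χ)) (freqDeriv i u) +
        (conv (freqDeriv i (scal χ)) (freqDeriv j u) + conv (scal χ) (freqDeriv i (freqDeriv j u))) :=
    fun i j => by
      rw [F1 j, freqDeriv_add, freqDeriv_conv (hs.freqDeriv j) hu i, freqDeriv_conv hs (hu.freqDeriv j) i]
  -- temperedness of the pieces
  have T1 : ∀ i j, Tempered (conv (freqDeriv i (freqDeriv j (scal χ))) u) := fun i j =>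
    hu.conv ((hs.freqDeriv j).freqDeriv i)
  have T2 : ∀ i j, Tempered (conv (freqDeriv j (scal χ)) (freqDeriv i u)) := fun i j =>
    (hu.freqDeriv i).conv (hs.freqDeriv j)
  have T3 : ∀ i j, Tempered (conv (freqDeriv i (scal χ)) (freqDeriv j u)) := fun i j =>
    (hu.freqDeriv j).conv (hs.freqDeriv i)
  have T4 : ∀ i j, Tempered (conv (scal χ) (freqDeriv i (freqDeriv j u))) := fun i j =>
    (hu.freqDeriv_freqDeriv i j).conv hs
  have tA : ∀ i j, Tempered (fun k => L.A i j (freqDeriv i (freqDeriv j u) k)) := fun i j =>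
    (hu.freqDeriv_freqDeriv i j).comp_apply _
  have tB : ∀ i j, Tempered (conv (L.b i j) (freqDeriv i (freqDeriv j u))) := fun i j =>
    (hu.freqDeriv_freqDeriv i j).conv (L.hb i j)
  have tC : ∀ j, Tempered (conv (L.c1 j) (freqDeriv j u)) := fun j => (hu.freqDeriv j).conv (L.hc1 j)
  have tD : Tempered (conv L.c0 u) := hu.conv L.hc0
  have tAs : ∀ i, Tempered (∑ j, fun k => L.A i j (freqDeriv i (freqDeriv j u) k)) := fun i =>
    Tempered.finset_sum Finset.univ fun j _ => tA i j
  have tBr : ∀ i, Tempered (∑ j, conv (L.b i j) (freqDeriv i (freqDeriv j u))) := fun i =>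
    Tempered.finset_sum Finset.univ fun j _ => tB i j
  have tBs : Tempered (∑ i, ∑ j, conv (L.b i j) (freqDeriv i (freqDeriv j u))) :=
    Tempered.finset_sum Finset.univ fun i _ => tBr i
  have tCs : Tempered (∑ j, conv (L.c1 j) (freqDeriv j u)) := Tempered.finset_sum Finset.univ fun j _ => tC j
  -- principal part, left: expand by Leibniz and pull the constant maps through
  have hPL : L.principal (conv (scal χ) u) = ∑ i, ∑ j,
      (conv (compLeft (L.A i j) (freqDeriv i (freqDeriv j (scal χ)))) u +
        conv (compLeft (L.A i j) (freqDeriv j (scal χ))) (freqDeriv i u) +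
        (conv (compLeft (L.A i j) (freqDeriv i (scal χ))) (freqDeriv j u) +
          conv (compLeft (L.A i j) (scal χ)) (freqDeriv i (freqDeriv j u)))) := by
    have h : L.principal (conv (scal χ) u) =
        ∑ i, ∑ j, fun k => L.A i j (freqDeriv i (freqDeriv j (conv (scal χ) u)) k) := by
      funext k; simp [principal, Finset.sum_apply]
    rw [h]
    refine Finset.sum_congr rfl fun i _ => Finset.sum_congr rfl fun j _ => ?_
    rw [F2 i j, ← comp_conv (L.A i j) ((hs.freqDeriv j).freqDeriv i) hu,
      ← comp_conv (L.A i j) (hs.freqDeriv j) (hu.freqDeriv i),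
      ← comp_conv (L.A i j) (hs.freqDeriv i) (hu.freqDeriv j),
      ← comp_conv (L.A i j) hs (hu.freqDeriv_freqDeriv i j)]
    funext k
    simp only [Pi.add_apply, map_add]
  -- principal part, right
  have hPR : conv (scal χ) (L.principal u) =
      ∑ i, ∑ j, conv (compLeft (L.A i j) (scal χ)) (freqDeriv i (freqDeriv j u)) := by
    have h : L.principal u = ∑ i, ∑ j, fun k => L.A i j (freqDeriv i (freqDeriv j u) k) := by
      funext k; simp [principal, Finset.sum_apply]
    rw [h, conv_finset_sum Finset.univ hsW (fun i _ => tAs i)]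
    refine Finset.sum_congr rfl fun i _ => ?_
    rw [conv_finset_sum Finset.univ hsW (fun j _ => tA i j)]
    refine Finset.sum_congr rfl fun j _ => ?_
    rw [← comp_conv_scal (L.A i j) hχ (hu.freqDeriv_freqDeriv i j),
      comp_conv (L.A i j) hs (hu.freqDeriv_freqDeriv i j)]
  -- perturbation part
  have hBL : ∀ i j, conv (L.b i j) (freqDeriv i (freqDeriv j (conv (scal χ) u))) =
      conv (sconv (L.b i j) (freqDeriv i (freqDeriv j (scal χ)))) u +
        conv (sconv (L.b i j) (freqDeriv j (scal χ))) (freqDeriv i u) +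
        (conv (sconv (L.b i j) (freqDeriv i (scal χ))) (freqDeriv j u) +
          conv (sconv (L.b i j) (scal χ)) (freqDeriv i (freqDeriv j u))) := fun i j => by
    rw [F2 i j, conv_add (L.hb i j) ((T1 i j).add (T2 i j)) ((T3 i j).add (T4 i j)),
      conv_add (L.hb i j) (T1 i j) (T2 i j), conv_add (L.hb i j) (T3 i j) (T4 i j),
      conv_conv (L.hb i j) ((hs.freqDeriv j).freqDeriv i) hu, conv_conv (L.hb i j) (hs.freqDeriv j) (hu.freqDeriv i),
      conv_conv (L.hb i j) (hs.freqDeriv i) (hu.freqDeriv j), conv_conv (L.hb i j) hs (hu.freqDeriv_freqDeriv i j)]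
  have hBR : conv (scal χ) (∑ i, ∑ j, conv (L.b i j) (freqDeriv i (freqDeriv j u))) =
      ∑ i, ∑ j, conv (sconv (L.b i j) (scal χ)) (freqDeriv i (freqDeriv j u)) := by
    rw [conv_finset_sum Finset.univ hsW (fun i _ => tBr i)]
    refine Finset.sum_congr rfl fun i _ => ?_
    rw [conv_finset_sum Finset.univ hsW (fun j _ => tB i j)]
    refine Finset.sum_congr rfl fun j _ => ?_
    rw [← conv_conv_scal (L.hb i j) hχ (hu.freqDeriv_freqDeriv i j),
      conv_conv (L.hb i j) hs (hu.freqDeriv_freqDeriv i j)]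
  -- first-order part
  have hCL : ∀ j, conv (L.c1 j) (freqDeriv j (conv (scal χ) u)) =
      conv (sconv (L.c1 j) (freqDeriv j (scal χ))) u + conv (sconv (L.c1 j) (scal χ)) (freqDeriv j u) := fun j => by
    rw [F1 j, conv_add (L.hc1 j) (hu.conv (hs.freqDeriv j)) ((hu.freqDeriv j).conv hs),
      conv_conv (L.hc1 j) (hs.freqDeriv j) hu, conv_conv (L.hc1 j) hs (hu.freqDeriv j)]
  have hCR : conv (scal χ) (∑ j, conv (L.c1 j) (freqDeriv j u)) =
      ∑ j, conv (sconv (L.c1 j) (scal χ)) (freqDeriv j u) := by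
    rw [conv_finset_sum Finset.univ hsW (fun j _ => tC j)]
    refine Finset.sum_congr rfl fun j _ => ?_
    rw [← conv_conv_scal (L.hc1 j) hχ (hu.freqDeriv j), conv_conv (L.hc1 j) hs (hu.freqDeriv j)]
  -- order zero
  have hDL : conv L.c0 (conv (scal χ) u) = conv (sconv L.c0 (scal χ)) u := conv_conv L.hc0 hs hu
  have hDR : conv (scal χ) (conv L.c0 u) = conv (sconv L.c0 (scal χ)) u := by
    rw [← conv_conv_scal L.hc0 hχ hu, conv_conv L.hc0 hs hu]
  -- the commutator applied to `u`
  have rA : ∀ i j, RapidDecay (compLeft (L.A i j) (freqDeriv i (scal χ)) + compLeft (L.A j i) (freqDeriv i (scal χ)) +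
      (sconv (L.b i j) (freqDeriv i (scal χ)) + sconv (L.b j i) (freqDeriv i (scal χ)))) := fun i j =>
    (((hs.freqDeriv i).compLeft (L.A i j)).add ((hs.freqDeriv i).compLeft (L.A j i))).add
      (((L.hb i j).sconv (hs.freqDeriv i)).add ((L.hb j i).sconv (hs.freqDeriv i)))
  have rA0 : ∀ i j, RapidDecay (compLeft (L.A i j) (freqDeriv i (freqDeriv j (scal χ))) +
      sconv (L.b i j) (freqDeriv i (freqDeriv j (scal χ)))) := fun i j =>
    (((hs.freqDeriv j).freqDeriv i).compLeft (L.A i j)).add ((L.hb i j).sconv ((hs.freqDeriv j).freqDeriv i))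
  have rC0 : ∀ j, RapidDecay (sconv (L.c1 j) (freqDeriv j (scal χ))) := fun j => (L.hc1 j).sconv (hs.freqDeriv j)
  have hM : (L.cutoffComm χ hχ).apply u =
      ∑ j, ∑ i, (conv (compLeft (L.A i j) (freqDeriv i (scal χ))) (freqDeriv j u) +
        conv (compLeft (L.A j i) (freqDeriv i (scal χ))) (freqDeriv j u) +
        (conv (sconv (L.b i j) (freqDeriv i (scal χ))) (freqDeriv j u) +
          conv (sconv (L.b j i) (freqDeriv i (scal χ))) (freqDeriv j u))) +
      (∑ i, ∑ j, (conv (compLeft (L.A i j) (freqDeriv i (freqDeriv j (scal χ)))) u +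
          conv (sconv (L.b i j) (freqDeriv i (freqDeriv j (scal χ)))) u) +
        ∑ j, conv (sconv (L.c1 j) (freqDeriv j (scal χ))) u) := by
    have h0 : (fun k => ∑ j, (L.cutoffComm χ hχ).P j (freqDeriv j u k)) = 0 := by
      funext k; simp
    rw [POp1.apply_def, h0, zero_add, cutoffComm_p0]
    simp only [cutoffComm_p]
    congr 1
    · refine Finset.sum_congr rfl fun j _ => ?_
      rw [finset_sum_conv _ (fun i _ => rA i j) (hu.freqDeriv j)]
      refine Finset.sum_congr rfl fun i _ => ?_
      rw [add_conv (((hs.freqDeriv i).compLeft (L.A i j)).add ((hs.freqDeriv i).compLeft (L.A j i)))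
          (((L.hb i j).sconv (hs.freqDeriv i)).add ((L.hb j i).sconv (hs.freqDeriv i))) (hu.freqDeriv j),
        add_conv ((hs.freqDeriv i).compLeft (L.A i j)) ((hs.freqDeriv i).compLeft (L.A j i)) (hu.freqDeriv j),
        add_conv ((L.hb i j).sconv (hs.freqDeriv i)) ((L.hb j i).sconv (hs.freqDeriv i)) (hu.freqDeriv j)]
    · rw [add_conv (RapidDecay.finset_sum _ fun i _ => RapidDecay.finset_sum _ fun j _ => rA0 i j)
          (RapidDecay.finset_sum _ fun j _ => rC0 j) hu,
        finset_sum_conv _ (fun i _ => RapidDecay.finset_sum _ fun j _ => rA0 i j) hu,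
        finset_sum_conv _ (fun j _ => rC0 j) hu]
      congr 1
      refine Finset.sum_congr rfl fun i _ => ?_
      rw [finset_sum_conv _ (fun j _ => rA0 i j) hu]
      refine Finset.sum_congr rfl fun j _ => ?_
      rw [add_conv (((hs.freqDeriv j).freqDeriv i).compLeft (L.A i j))
        ((L.hb i j).sconv ((hs.freqDeriv j).freqDeriv i)) hu]
  -- assemble
  rw [apply_def, apply_def, conv_add hsW (L.tempered_principal hu) (L.tempered_lower hu), lower_def, lower_def,
    conv_add hsW (tBs.add tCs) tD, conv_add hsW tBs tCs, hPL, hPR, hBR, hCR, hDR, hM]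
  simp only [hBL, hCL, hDL, Finset.sum_add_distrib]
  rw [Finset.sum_comm (f := fun a b => conv (compLeft (L.A b a) (freqDeriv b (scal χ))) (freqDeriv a u)),
    Finset.sum_comm (f := fun a b => conv (sconv (L.b b a) (freqDeriv b (scal χ))) (freqDeriv a u))]
  abel

end POp

/-! ### Locality: a first-order operator annihilated by `ψ - 1` does not see `ψ` -/

namespace POp1

variable [CompleteSpace V] [CompleteSpace W] (M : POp1 d V W)

/-- **Locality in symbolic form** (Warner 6.32 (15): "`M₂ũ = M₂v₁`, since `M₂` has support in `O₁`
and `ũ = v₁` on `O₁`", with `v₁ = ω₁ũ`). Let `M` be a first-order operator without constant part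
whose symbols satisfy `p_j ⋆ (ψ - 1) = 0`, `p₀ ⋆ (ψ - 1) = 0` and `p_j ⋆ ∂_jψ = 0` (products of
symbols; on the torus these say that `ψ ≡ 1` near the supports of the coefficients of `M`). Then
`M (ψ ⋆ u) = M u` for every tempered `u`. [cite: WarnerGTM94, 6.32 (15)] -/
theorem apply_conv_scal_eq (hP : ∀ j, M.P j = 0) {ψ : (d → ℤ) → ℂ} (hψ : RapidDecay ψ)
    (h0 : ∀ j, sconv (M.p j) (scal ψ - delta 1) = 0) (h1 : ∀ j, sconv (M.p j) (freqDeriv j (scal ψ)) = 0)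
    (h2 : sconv M.p0 (scal ψ - delta 1) = 0) {u : (d → ℤ) → V} (hu : Tempered u) :
    M.apply (conv (scal ψ) u) = M.apply u := by
  have hs : RapidDecay (scal ψ : (d → ℤ) → (V →L[ℂ] V)) := hψ.scal
  -- `p ⋆ ψ = p` from `p ⋆ (ψ - 1) = 0`
  have hfix : ∀ {p : (d → ℤ) → (V →L[ℂ] W)}, RapidDecay p → sconv p (scal ψ - delta 1) = 0 →
      sconv p (scal ψ) = p := fun {p} hp h => by
    rwa [sconv_sub hp hs (rapidDecay_delta 1), sconv_delta_one hp, sub_eq_zero] at h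
  have hzero : ∀ k, (fun k => ∑ j, M.P j (freqDeriv j (conv (scal ψ) u) k)) k =
      (fun k => ∑ j, M.P j (freqDeriv j u k)) k := fun k => by simp [hP]
  rw [apply_def, apply_def, funext hzero, conv_conv M.hp0 hs hu, hfix M.hp0 h2]
  congr 2
  refine Finset.sum_congr rfl fun j _ => ?_
  rw [freqDeriv_conv hs hu j, conv_add (M.hp j) (hu.conv (hs.freqDeriv j)) ((hu.freqDeriv j).conv hs),
    conv_conv (M.hp j) (hs.freqDeriv j) hu, conv_conv (M.hp j) hs (hu.freqDeriv j), h1 j, hfix (M.hp j) (h0 j),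
    zero_conv, zero_add]

end POp1

end Lattice

end Literature.Analysis.FunctionSpaces
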